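import Mathlib.RingTheory.Polynomial.Chebyshev
import Mathlib.Algebra.BigOperators.NatAntidiagonal
import Mathlib.Data.Real.Basic
import HarnessLib

/-!
# The multiplicities of the three-dimensional lens spaces `L(q; p₁, p₂)` — the definitions (Ikeda–Yamamoto 1979 §2–§3):
# the characters `χ_k` of `P_k` and `χ̃_k = χ_k − χ_{k−2}` of `H_k` on the maximal torus of `U(2)`, `dim P_k^G`, and
# `dim E_{k(k+2)} = dim H_k^G = dim P_k^G − dim P_{k−2}^G`

Layer `Literature/Analysis/InnerProduct`, namespace `Literature.Analysis.InnerProduct`; lane `lit-hodgefound`, prover seat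
`lit-hodgefound-p06`, generation 43, row g43-#2 (definitions file; every printed property — the multiplicity formula (3.10), Theorem 3.2's
generating function termwise, the closed forms of `χ̃_k`, the values for `S³`, `RP³` — is PROVED in the companion
`LensSpaceSpectrum.lean`, and the heat trace of `L(q;p₁,p₂)` to all orders in `LensSpaceHeatTraceExpansion.lean`). Four definitions
with bodies; no instance, no notation, no named fact, no theorem.

## Source, verbatim (held text `paper:doi-10-18910-4811`)

A. Ikeda, Y. Yamamoto, *On the spectra of 3-dimensional lens spaces*, Osaka J. Math. **16** (1979) 447–469: "**Corollary 1.4.** …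
`dim E_λ = dim (Ẽ_λ)^G`." (p0005) "We denote by `P_k` the space of homogeneous polynomials of degree `k` with respect to `z₀, …, z_n,
z̄₀, …, z̄_n` and `H_k` the subspace of `P_k` consisting of harmonic polynomials on `ℂ^{n+1}` … **Proposition 2.1.** … `P_k = H_k ⊕
r²P_{k−2}`. … **Proposition 2.2.** `ℋ_k` is an eigenspace of `Δ` on `S^{2n+1}` with eigenvalue `k(k+2n)` … **Corollary 2.3.** Let
`L(q : p₀, ⋯, p_n)` be a lens space and `ℋ_k^G` the space of all `G`-invariant functions in `ℋ_k` where `G = {g^k}_{k=0,1,…,q−1}`. Then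
we have `dim E_{k(k+2n)} = dim ℋ_k^G`. Moreover, for any integer `k` such that `dim ℋ_k^G ≠ 0`, `k(k+2n)` is an eigenvalue of `Δ` on
`L(q : p₀, ⋯, p_n)` with multiplicity `dim ℋ_k^G` and no other eigenvalues appear in the spectrum of `Δ`." (p0006) "Let `χ_k` (resp.
`χ̃_k`) be the character of the `G`-module `P_k` (resp. `H_k`). Then by Proposition 2.1, we have (3.1) `χ̃_k = χ_k − χ_{k−2}`, where
`χ_{−t} = 0` for `t > 0`, since `r²` is invariant by `G`. The space `P_k` has a base consisting of all monomials of the form (3.2)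
`z^I·z̄^J` … Let `g` be the generator of `G` and `γ = exp 2π√−1/q`. Then for any monomial `z^I·z̄^J`, we have (3.3) `g(z^I·z̄^J) =
γ^{i₀p₀+⋯+i_np_n−j₀p₀−⋯−j_np_n}z^I·z̄^J`. Consider the formal expansion of (3.4) `∏_{i=0}^{n}(1 − γ^{p_il}z)^{−1}(1 − γ^{−p_il}z)^{−1}`.
Then it is easy to see that `χ_k(g^l)` is equal to the `z^k`'s coefficient of (3.4)" (p0006–p0007); "(3.10) `dim ℋ_k^G =
(1/q)∑_{l=0}^{q−1}(χ_k(g^l) − χ_{k−2}(g^l))`" (p0007). Here `n + 1 = 2`, `G ⊂ U(2)`, `g^l = diag(γ^{p₁l}, γ^{p₂l})`.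

## The dictionary

One factor of (3.4) at a torus element `e^{iφ}` is `(1 − e^{iφ}z)^{−1}(1 − e^{−iφ}z)^{−1} = (1 − 2cos φ·z + z²)^{−1} = ∑_i U_i(cos φ)zⁱ`
(Chebyshev polynomials of the second kind; `U_i(cos φ) = ∑_{a+b=i} e^{i(a−b)φ}`), so `χ_k(diag(e^{iφ₁}, e^{iφ₂})) = ∑_{i+j=k}
U_i(cos φ₁)U_j(cos φ₂)`: we define `χ_k(c₁, c₂) := ∑_{i+j=k} U_i(c₁)U_j(c₂)` and `χ̃_k := χ_k − [k ≥ 2]χ_{k−2}` as polynomial functions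
of `cᵢ = cos φᵢ`. By (3.2)–(3.3) and the orthogonality of the characters of `G ≅ ℤ/q`, `dim P_k^G` is the number of monomials
`z₁^a z̄₁^b z₂^c z̄₂^d`, `a+b+c+d = k`, with `q ∣ (a−b)p₁ + (c−d)p₂`; by Corollary 2.3 and (3.1), `dim E_{k(k+2)} = dim H_k^G =
dim P_k^G − [k ≥ 2]dim P_{k−2}^G` (the subtraction does not truncate: `dim P_{k−2}^G ≤ dim P_k^G` by multiplication with `z₁z̄₁`,
`LensSpaceSpectrum.lensMonomialCount_le_add_two`).

## References

* [IkedaYamamoto1979] A. Ikeda, Y. Yamamoto, *On the spectra of 3-dimensional lens spaces*, Osaka J. Math. 16 (1979) 447–469,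
  Corollary 1.4, Propositions 2.1–2.2, Corollary 2.3, §3 (3.1)–(3.4), (3.10).
* [Ikeda1980] A. Ikeda, *On lens spaces which are isospectral but not isometric*, Ann. Sci. ÉNS (4) 13 (1980) 303–315, §2 (2.1)–(2.3).
-/

noncomputable section

open Finset Polynomial.Chebyshev

namespace Literature.Analysis.InnerProduct

/-! ### The characters of `P_k` and `H_k` on the maximal torus of `U(2)`, the invariant-monomial count, the multiplicity -/

/-- **The character of `P_k`** (homogeneous polynomials of degree `k` in `z₁, z₂, z̄₁, z̄₂`) at the torus element
`diag(e^{iφ₁}, e^{iφ₂}) ∈ U(2)`, as a function of `cᵢ = cos φᵢ`: `χ_{P_k} = ∑_{i+j=k} U_i(c₁)U_j(c₂)` (`U_i` the Chebyshev polynomial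
of the second kind: `U_i(cos φ) = ∑_{a+b=i} e^{i(a−b)φ}` is the character of the monomials `z^az̄^b` of degree `i` in one variable;
`threeSphereMonomialCharacter_cos_cos` in `LensSpaceSpectrum.lean`). It is the `z^k`-coefficient of Ikeda–Yamamoto's
`∏ᵢ(1 − γ^{pᵢl}z)^{−1}(1 − γ^{−pᵢl}z)^{−1}` (`LensSpaceSpectrum.lean` §4). [cite: IkedaYamamoto1979, §3 (3.2)–(3.5) (`n + 1 = 2`)] -/
def threeSphereMonomialCharacter (k : ℕ) (c₁ c₂ : ℝ) : ℝ :=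
  ∑ ij ∈ antidiagonal k, (U ℝ ij.1).eval c₁ * (U ℝ ij.2).eval c₂

/-- **The character of `H_k`** (harmonic polynomials of degree `k` on `ℂ²`, i.e. the eigenspace of `Δ_{S³}` for `k(k+2)`) at
`diag(e^{iφ₁}, e^{iφ₂})`, as a function of `cᵢ = cos φᵢ`: `χ̃_k = χ_k − χ_{k−2}` ("`P_k = H_k ⊕ r²P_{k−2}`", with `χ_{−1} = χ_{−2} = 0`).
[cite: IkedaYamamoto1979, Proposition 2.1 and §3 (3.1)] -/
def threeSphereHarmonicCharacter (k : ℕ) (c₁ c₂ : ℝ) : ℝ :=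
  threeSphereMonomialCharacter k c₁ c₂ - if 2 ≤ k then threeSphereMonomialCharacter (k - 2) c₁ c₂ else 0

/-- **`dim P_k^G` for the lens space `L(q; p₁, p₂) = S³/G`**, `G = ⟨g⟩`, `g = diag(γ^{p₁}, γ^{p₂})`, `γ = e^{2πi/q}`: the number of
monomials `z₁^a z̄₁^b z₂^c z̄₂^d` of degree `a+b+c+d = k` with `g(z₁^a z̄₁^b z₂^c z̄₂^d) = γ^{(a−b)p₁+(c−d)p₂}·(…)` invariant, i.e.
`q ∣ (a−b)p₁ + (c−d)p₂` ("The space `P_k` has a base consisting of all monomials … `g(z^I z̄^J) = γ^{i₀p₀+⋯−j₀p₀−⋯}z^I z̄^J`").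
[cite: IkedaYamamoto1979, §3 (3.2)–(3.3)] -/
def lensMonomialCount (q : ℕ) (p₁ p₂ : ℤ) (k : ℕ) : ℕ :=
  ∑ ij ∈ antidiagonal k, ∑ ab ∈ antidiagonal ij.1, ∑ cd ∈ antidiagonal ij.2,
    if (q : ℤ) ∣ ((ab.1 : ℤ) - ab.2) * p₁ + ((cd.1 : ℤ) - cd.2) * p₂ then 1 else 0

/-- **THE MULTIPLICITY OF `k(k+2)` IN THE SPECTRUM OF THE LENS SPACE `L(q; p₁, p₂)`**: `dim E_{k(k+2)} = dim H_k^G =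
dim P_k^G − dim P_{k−2}^G` ("`dim E_{k(k+2)} = dim H_k^G`", Corollary 2.3, with `P_k = H_k ⊕ r²P_{k−2}` as `G`-modules, `r²`
being `G`-invariant); for `k < 2` it is `dim P_k^G`. The heat trace of `L(q;p₁,p₂)` is `∑_k (lensMultiplicity q p₁ p₂ k)e^{−tk(k+2)}`.
[cite: IkedaYamamoto1979, Corollary 2.3, Proposition 2.1, §3 (3.1) and (3.10)] -/
def lensMultiplicity (q : ℕ) (p₁ p₂ : ℤ) (k : ℕ) : ℕ :=
  lensMonomialCount q p₁ p₂ k - if 2 ≤ k then lensMonomialCount q p₁ p₂ (k - 2) else 0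

end Literature.Analysis.InnerProduct
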